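import Summits.Ventures.PackingBounds.Energy.TenPointPetQ1
import Summits.Ventures.PackingBounds.Configurations.PetersenCode
import HarnessLib

/-!
# Ten points on `S³`, potential `(1 + t) ^ 7 * (t + 2 / 3)`: the two-sided statement (the Petersen code is optimal)

Framing: lottery ticket; floor = certified bounds/negative ranges. Venture `PackingBounds`, cell
`pub-packcert`, energy family E3PT (pub-packcert-energy gen 14; n = 4 kernel route = KERNEL-D6 data route + `threePointF 4`).

Combines `TenPointPetQ1.petq1_ten_points` with `Config.PetersenCode.exists_config` (inner products `1/6` six times, `-2/3` three times per point):
the minimum of `Σ_{x≠y} (1 + ⟪x,y⟫) ^ 7 * (⟪x,y⟫ + 2 / 3)` over ten unit vectors of `ℝ⁴` is `20588575/139968`. One of the finitely many basis potentials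
`(1+t)^7 · Π_{i<m}(t - t_i)`, `T = (-2/3, -2/3, 1/6, 1/6)`, of Cohn–Woo's reduction (J. AMS 2012, Lemma 10 / Cor. 11, spherical analogue, §5.3)
of 'the Petersen code minimises the `(1+t)^k`-energy for every `k ≥ 7`' to a finite basis.
-/

noncomputable section

open Finset
open scoped RealInnerProductSpace

namespace Summit.Ventures.PackingBounds.Energy.TenPointPetQ1

open Summit.Ventures.PackingBounds.Config

/-- The Petersen code attains `20588575/139968`. -/
theorem petersen_petq1_ten_points_energy : ∃ C : Finset (EuclideanSpace ℝ (Fin 4)), C.card = 10 ∧ (∀ x ∈ C, ‖x‖ = 1) ∧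
    ∑ x ∈ C, ∑ y ∈ C.erase x, (1 + inner ℝ x y) ^ 7 * (inner ℝ x y + 2 / 3) = ((20588575 : ℝ)/139968) := by
  obtain ⟨C, hc, hn, _, he⟩ := PetersenCode.exists_config
  refine ⟨C, hc, hn, ?_⟩
  rw [he (fun t : ℝ => (1 + t) ^ 7 * (t + 2 / 3))]
  norm_num

/-- **Two-sided:** the least value of `Σ_{x ≠ y} (1 + ⟪x,y⟫) ^ 7 * (⟪x,y⟫ + 2 / 3)` over ten unit vectors of `ℝ⁴` is `20588575/139968` (Petersen code). -/
theorem petq1_ten_points_isLeast :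
    IsLeast {E : ℝ | ∃ C : Finset (EuclideanSpace ℝ (Fin 4)), C.card = 10 ∧ (∀ x ∈ C, ‖x‖ = 1) ∧
      E = ∑ x ∈ C, ∑ y ∈ C.erase x, (1 + inner ℝ x y) ^ 7 * (inner ℝ x y + 2 / 3)} (((20588575 : ℝ)/139968)) := by
  obtain ⟨C0, hc0, hn0, he0⟩ := petersen_petq1_ten_points_energy
  refine ⟨⟨C0, hc0, hn0, he0.symm⟩, ?_⟩
  rintro E ⟨C, h10, hC, rfl⟩
  exact petq1_ten_points C hC h10

end Summit.Ventures.PackingBounds.Energy.TenPointPetQ1
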